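import Literature.NumberTheory.DiophantineGeometry.AbcShapeGeometrySets
import Literature.NumberTheory.DiophantineGeometry.SquarefulSumsDetMethod
import Literature.NumberTheory.DiophantineGeometry.SquarefulSumsCountingTools
import Summits.ABC.ABC.Theorems.TwistAmplificationMazurKaneLawDetToolRoots

-- Summit.ABC.ABC is the mandated summit-side namespace (single-conjunct summit); the lakefile sets the same option tree-wide.
set_option linter.dupNamespace false

/-!
# The determinant tool for the shape count `B_d` at one coordinate (crux stmt-ABC-2757, stub `detTool`)

Stub S2 of the line `fibre-toolkit-lp-wall-map` for the crux
`Summit.ABC.ABC.Theses.TwistAmplification.MazurKaneLaw`.  The shape count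
`B_d = AbcShapes.shapeCount c₁ c₂ c₃ X Y Z` counts the `(x, y, z)` in the dyadic boxes
`[X, 2X) × [Y, 2Y) × [Z, 2Z)` with `c₁ ∏ xⱼ^{j+1} + c₂ ∏ yⱼ^{j+1} = c₃ ∏ zⱼ^{j+1}` and
`gcd(c₁ ∏ xⱼ, c₂ ∏ yⱼ, c₃ ∏ zⱼ) = 1`.  The tool (`Summit.ABC.ABC.Theorems.MazurKaneLaw.detTool`)
bounds `B_d` by the elementary determinant method at a coordinate `i ≥ 1`:

* freeze every coordinate `j ≠ i` (fibres indexed by `subBox {i} X × subBox {i} Y × subBox {i} Z`,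
  exactly as in `AbcShapes.shapeCount_le_geometry_sets`); on the fibre over `(r₁, r₂, r₃)` the
  equation reads `A x^{i+1} + B y^{i+1} = C z^{i+1}` with `A = c₁ offVal_{i}(r₁)`,
  `B = c₂ offVal_{i}(r₂)`, `C = c₃ offVal_{i}(r₃) ≤ T`, unknowns `x = x_i ∈ [Xᵢ, 2Xᵢ)` etc., and
  `gcd(A x^{i+1}, B y^{i+1}) = 1` (`AbcShapes.coprime_terms_of_mem`);
* an auxiliary prime `p ∈ (P, 2P]` with `p ∤ (i+1)ABC` exists by
  `SquarefulCount.exists_prime_Ioc_not_dvd` (its threshold is the `N₀` of the theorem; the size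
  hypothesis `2 log((i+2)T³) ≤ P` gives `log((i+1)ABC) ≤ P/2`);
* the hypothesis `48 XᵢYᵢZᵢ ≤ A₀B₀C₀ P³` with the corner cofactors `A₀ = c₁ offVal_{i}(X) ≤ A`
  gives the size condition `48 XᵢYᵢZᵢ < ABC p³` of the fibre bound `detToolFibre`
  (`SquarefulDet.fiberBound` plus the root count `#μ_{i+1}(ZMod m) ≤ τ(m)^{i+2} ≤ Dτ^{i+2}`), so each
  fibre has at most `2(i+2) · 3(i+1)p · Dτ^{3(i+2)} ≤ Dτ^{3(i+2)} · 24(i+1)(i+2) · P` points (a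
  factor `2` of slack);
* summing over the `#subBox{i}X · #subBox{i}Y · #subBox{i}Z` fibres gives the stated bound.
-/

namespace Summit.ABC.ABC.Theorems.MazurKaneLaw

open Finset
open Literature.NumberTheory.DiophantineGeometry
open Literature.NumberTheory.DiophantineGeometry.AbcShapes

/-- **The determinant tool for `B_d` at a coordinate `i ≥ 1`.** There is `N₀ > 0` such that for
positive `cᵢ`, boxes with positive parameters, `T ≥ cᵢ · ∏ⱼ (2·)^{j+1}`, `τ(m) ≤ Dτ` for
`1 ≤ m ≤ T`, a coordinate `i ≥ 1` and `P ≥ N₀` with `2 log((i+2)T³) ≤ P` and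
`48 XᵢYᵢZᵢ ≤ (c₁ offVal_{i} X)(c₂ offVal_{i} Y)(c₃ offVal_{i} Z) P³`, one has
`B_d ≤ #subBox{i}X · #subBox{i}Y · #subBox{i}Z · Dτ^{3(i+2)} · 24(i+1)(i+2) · P`.
Proof: fibre over the frozen coordinates `j ≠ i`; on a non-empty fibre the equation is
`A x^{i+1} + B y^{i+1} = C z^{i+1}` with `gcd(A x^{i+1}, B y^{i+1}) = 1`, an auxiliary prime
`p ∈ (P, 2P]`, `p ∤ (i+1)ABC`, exists (`SquarefulCount.exists_prime_Ioc_not_dvd`), and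
`detToolFibre` (the elementary determinant method `SquarefulDet.fiberBound`) counts the fibre.
[folklore] -/
theorem detTool : ∃ N₀ : ℝ, 0 < N₀ ∧ ∀ {d : ℕ} {c₁ c₂ c₃ : ℕ}, 0 < c₁ → 0 < c₂ → 0 < c₃ → ∀ (X Y Z : Fin d → ℕ), (∀ j, 0 < X j) → (∀ j, 0 < Y j) → (∀ j, 0 < Z j) → ∀ {T Dτ : ℕ}, c₁ * Literature.NumberTheory.DiophantineGeometry.AbcShapes.shapeVal (fun j => 2 * X j) ≤ T → c₂ * Literature.NumberTheory.DiophantineGeometry.AbcShapes.shapeVal (fun j => 2 * Y j) ≤ T → c₃ * Literature.NumberTheory.DiophantineGeometry.AbcShapes.shapeVal (fun j => 2 * Z j) ≤ T → (∀ m : ℕ, m ≠ 0 → m ≤ T → m.divisors.card ≤ Dτ) → ∀ i : Fin d, 1 ≤ (i : ℕ) → ∀ P : ℝ, N₀ ≤ P → 2 * Real.log ((((i : ℕ) : ℝ) + 2) * (T : ℝ) ^ 3) ≤ P → 48 * ((X i : ℝ) * Y i * Z i) ≤ ((c₁ * Literature.NumberTheory.DiophantineGeometry.AbcShapes.offVal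 ({i} : Finset (Fin d)) X : ℕ) : ℝ) * ((c₂ * Literature.NumberTheory.DiophantineGeometry.AbcShapes.offVal ({i} : Finset (Fin d)) Y : ℕ) : ℝ) * ((c₃ * Literature.NumberTheory.DiophantineGeometry.AbcShapes.offVal ({i} : Finset (Fin d)) Z : ℕ) : ℝ) * P ^ 3 → (Literature.NumberTheory.DiophantineGeometry.AbcShapes.shapeCount c₁ c₂ c₃ X Y Z : ℝ) ≤ ((Literature.NumberTheory.DiophantineGeometry.AbcShapes.subBox ({i} : Finset (Fin d)) X).card * (Literature.NumberTheory.DiophantineGeometry.AbcShapes.subBox ({i} : Finset (Fin d)) Y).card * (Literature.NumberTheory.DiophantineGeometry.AbcShapes.subBox ({i} : Finset (Fin d)) Z).card : ℕ) * (Dτ : ℝ) ^ (3 * ((i : ℕ) + 2)) * (24 * ((((i : ℕ) : ℝ) + 1) * (((i : ℕ) : ℝ) + 2))) * P := by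
  classical
  obtain ⟨N₀, hN₀, hprime⟩ := SquarefulCount.exists_prime_Ioc_not_dvd
  refine ⟨N₀, hN₀, ?_⟩
  intro d c₁ c₂ c₃ hc₁ hc₂ hc₃ X Y Z hX hY hZ T Dτ hTX hTY hTZ hD i hi P hP hlog h48
  set S : Finset (Fin d) := {i} with hS
  set F := shapeTriples c₁ c₂ c₃ X Y Z with hF
  set O := subBox S X ×ˢ subBox S Y ×ˢ subBox S Z with hO
  set φ : (Fin d → ℕ) × (Fin d → ℕ) × (Fin d → ℕ) → (Fin d → ℕ) × (Fin d → ℕ) × (Fin d → ℕ) :=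
    fun t => (freezeOn S X t.1, freezeOn S Y t.2.1, freezeOn S Z t.2.2) with hφ
  have hmaps : Set.MapsTo φ (F : Set _) (O : Set _) := by
    intro t ht
    obtain ⟨hbox, -⟩ := mem_filter.mp (mem_coe.mp ht)
    simp only [mem_product] at hbox
    exact mem_coe.mpr (mem_product.mpr ⟨freezeOn_mem_subBox S hbox.1,
      mem_product.mpr ⟨freezeOn_mem_subBox S hbox.2.1, freezeOn_mem_subBox S hbox.2.2⟩⟩)
  have hP0 : 0 < P := lt_of_lt_of_le hN₀ hP
  -- general facts on the frozen value `W_{i}` and the cofactor `offVal_{i}`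
  have honS : ∀ u : Fin d → ℕ, onVal S u = u i ^ ((i : ℕ) + 1) := fun u => by simp [hS, onVal]
  have hoffle : ∀ {W r : Fin d → ℕ}, (∀ j, 0 < r j) → (∀ j, r j ≤ 2 * W j) →
      offVal S r ≤ shapeVal (fun j => 2 * W j) := by
    intro W r hr hle
    calc offVal S r ≤ offVal S r * onVal S r :=
          Nat.le_mul_of_pos_right _ (prod_pos fun j _ => pow_pos (hr j) _)
      _ = shapeVal r := (shapeVal_eq_offVal_mul_onVal S r).symm
      _ ≤ shapeVal (fun j => 2 * W j) := shapeVal_mono hle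
  have hoffmono : ∀ {u v : Fin d → ℕ}, (∀ j, u j ≤ v j) → offVal S u ≤ offVal S v := fun h =>
    prod_le_prod (fun _ _ => Nat.zero_le _) fun j _ => Nat.pow_le_pow_left (h j) _
  set Bnd : ℝ := (Dτ : ℝ) ^ (3 * ((i : ℕ) + 2)) * (24 * ((((i : ℕ) : ℝ) + 1) * (((i : ℕ) : ℝ) + 2))) * P
    with hBnd
  have hBnd0 : 0 ≤ Bnd := by positivity
  /- the bound on one fibre -/
  have hfib : ∀ o ∈ O, ((F.filter (fun t => φ t = o)).card : ℝ) ≤ Bnd := by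
    rintro ⟨ox, oy, oz⟩ ho
    set Fo := F.filter (fun t => φ t = (ox, oy, oz)) with hFo
    simp only [hO, mem_product] at ho
    obtain ⟨hox, hoy, hoz⟩ := ho
    have hbx := mem_dyadicBox.mp (subBox_subset hX hox)
    have hby := mem_dyadicBox.mp (subBox_subset hY hoy)
    have hbz := mem_dyadicBox.mp (subBox_subset hZ hoz)
    have hoxpos : ∀ j, 0 < ox j := fun j => lt_of_lt_of_le (hX j) (hbx j).1
    have hoypos : ∀ j, 0 < oy j := fun j => lt_of_lt_of_le (hY j) (hby j).1
    have hozpos : ∀ j, 0 < oz j := fun j => lt_of_lt_of_le (hZ j) (hbz j).1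
    -- the coefficients of the fibre equation
    set A : ℕ := c₁ * offVal S ox with hA
    set B : ℕ := c₂ * offVal S oy with hB
    set C : ℕ := c₃ * offVal S oz with hC
    have hApos : 0 < A := Nat.mul_pos hc₁ (prod_pos fun j _ => pow_pos (hoxpos j) _)
    have hBpos : 0 < B := Nat.mul_pos hc₂ (prod_pos fun j _ => pow_pos (hoypos j) _)
    have hCpos : 0 < C := Nat.mul_pos hc₃ (prod_pos fun j _ => pow_pos (hozpos j) _)
    have hAT : A ≤ T := (Nat.mul_le_mul_left c₁ (hoffle hoxpos fun j => (hbx j).2.le)).trans hTX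
    have hBT : B ≤ T := (Nat.mul_le_mul_left c₂ (hoffle hoypos fun j => (hby j).2.le)).trans hTY
    have hCT : C ≤ T := (Nat.mul_le_mul_left c₃ (hoffle hozpos fun j => (hbz j).2.le)).trans hTZ
    have hA₀ : c₁ * offVal S X ≤ A := Nat.mul_le_mul_left c₁ (hoffmono fun j => (hbx j).1)
    have hB₀ : c₂ * offVal S Y ≤ B := Nat.mul_le_mul_left c₂ (hoffmono fun j => (hby j).1)
    have hC₀ : c₃ * offVal S Z ≤ C := Nat.mul_le_mul_left c₃ (hoffmono fun j => (hbz j).1)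
    -- what membership in the fibre means
    have hmem : ∀ t ∈ Fo, (t.1 ∈ dyadicBox X ∧ t.2.1 ∈ dyadicBox Y ∧ t.2.2 ∈ dyadicBox Z) ∧
        (freezeOn S X t.1 = ox ∧ freezeOn S Y t.2.1 = oy ∧ freezeOn S Z t.2.2 = oz) ∧
        A * t.1 i ^ ((i : ℕ) + 1) + B * t.2.1 i ^ ((i : ℕ) + 1) = C * t.2.2 i ^ ((i : ℕ) + 1) ∧
        Nat.Coprime (A * t.1 i ^ ((i : ℕ) + 1)) (B * t.2.1 i ^ ((i : ℕ) + 1)) := by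
      intro t ht
      obtain ⟨htF, hφt⟩ := mem_filter.mp ht
      have hcop := coprime_terms_of_mem htF
      obtain ⟨hbox, heq, -⟩ := mem_filter.mp htF
      simp only [hφ, Prod.mk.injEq] at hφt
      obtain ⟨h1, h2, h3⟩ := hφt
      have e1 : c₁ * shapeVal t.1 = A * t.1 i ^ ((i : ℕ) + 1) := by
        rw [shapeVal_eq_offVal_mul_onVal S t.1, ← offVal_freezeOn S X t.1, h1, honS, hA, mul_assoc]
      have e2 : c₂ * shapeVal t.2.1 = B * t.2.1 i ^ ((i : ℕ) + 1) := by
        rw [shapeVal_eq_offVal_mul_onVal S t.2.1, ← offVal_freezeOn S Y t.2.1, h2, honS, hB,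
          mul_assoc]
      have e3 : c₃ * shapeVal t.2.2 = C * t.2.2 i ^ ((i : ℕ) + 1) := by
        rw [shapeVal_eq_offVal_mul_onVal S t.2.2, ← offVal_freezeOn S Z t.2.2, h3, honS, hC,
          mul_assoc]
      refine ⟨by simpa only [mem_product] using hbox, ⟨h1, h2, h3⟩, ?_, ?_⟩
      · rw [← e1, ← e2, ← e3]; exact heq
      · rw [← e1, ← e2]; exact hcop
    rcases Fo.eq_empty_or_nonempty with he | ⟨t₀, ht₀⟩
    · rw [he, card_empty, Nat.cast_zero]; exact hBnd0
    -- the auxiliary prime `p ∈ (P, 2P]`, `p ∤ (i+1)ABC`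
    have hm0 : ((i : ℕ) + 1) * (A * B * C) ≠ 0 := by positivity
    have hlogm : Real.log ((((i : ℕ) + 1) * (A * B * C) : ℕ) : ℝ) ≤ P / 2 := by
      have h1 : ((((i : ℕ) + 1) * (A * B * C) : ℕ) : ℝ) ≤ (((i : ℕ) : ℝ) + 2) * (T : ℝ) ^ 3 := by
        have h : ((i : ℕ) + 1) * (A * B * C) ≤ ((i : ℕ) + 2) * T ^ 3 :=
          calc ((i : ℕ) + 1) * (A * B * C) ≤ ((i : ℕ) + 2) * (T * T * T) :=
                Nat.mul_le_mul (by omega) (Nat.mul_le_mul (Nat.mul_le_mul hAT hBT) hCT)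
            _ = ((i : ℕ) + 2) * T ^ 3 := by ring
        exact_mod_cast h
      have h0 : (0 : ℝ) < ((((i : ℕ) + 1) * (A * B * C) : ℕ) : ℝ) := by
        exact_mod_cast Nat.pos_of_ne_zero hm0
      have := Real.log_le_log h0 h1
      linarith
    obtain ⟨p, hp, hPp, hp2P, hpm⟩ := hprime P hP _ hm0 hlogm
    -- the size condition `48 XᵢYᵢZᵢ < ABC p³`
    have hsize : 48 * (X i * Y i * Z i) < A * B * C * p ^ 3 := by
      have hoX : 0 < c₁ * offVal S X := Nat.mul_pos hc₁ (prod_pos fun j _ => pow_pos (hX j) _)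
      have hoY : 0 < c₂ * offVal S Y := Nat.mul_pos hc₂ (prod_pos fun j _ => pow_pos (hY j) _)
      have hoZ : 0 < c₃ * offVal S Z := Nat.mul_pos hc₃ (prod_pos fun j _ => pow_pos (hZ j) _)
      have h1 : ((c₁ * offVal S X : ℕ) : ℝ) * ((c₂ * offVal S Y : ℕ) : ℝ) * ((c₃ * offVal S Z : ℕ) : ℝ)
          ≤ ((A * B * C : ℕ) : ℝ) := by
        exact_mod_cast Nat.mul_le_mul (Nat.mul_le_mul hA₀ hB₀) hC₀
      have h2 : P ^ 3 < (p : ℝ) ^ 3 := pow_lt_pow_left₀ hPp hP0.le (by norm_num)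
      have h3 : (0 : ℝ) < ((c₁ * offVal S X : ℕ) : ℝ) * ((c₂ * offVal S Y : ℕ) : ℝ) *
          ((c₃ * offVal S Z : ℕ) : ℝ) := by positivity
      have h4 : ((48 * (X i * Y i * Z i) : ℕ) : ℝ) < ((A * B * C * p ^ 3 : ℕ) : ℝ) := by
        calc ((48 * (X i * Y i * Z i) : ℕ) : ℝ) = 48 * ((X i : ℝ) * Y i * Z i) := by push_cast; ring
          _ ≤ _ := h48
          _ < ((c₁ * offVal S X : ℕ) : ℝ) * ((c₂ * offVal S Y : ℕ) : ℝ) *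
                ((c₃ * offVal S Z : ℕ) : ℝ) * (p : ℝ) ^ 3 := mul_lt_mul_of_pos_left h2 h3
          _ ≤ ((A * B * C : ℕ) : ℝ) * (p : ℝ) ^ 3 := mul_le_mul_of_nonneg_right h1 (by positivity)
          _ = ((A * B * C * p ^ 3 : ℕ) : ℝ) := by push_cast; ring
      exact_mod_cast h4
    -- the fibre injects into the triples counted by `detToolFibre`
    have hinj : Fo.card ≤ ((Finset.range (2 * X i) ×ˢ Finset.range (2 * Y i) ×ˢ
        Finset.range (2 * Z i)).filter fun t : ℕ × ℕ × ℕ =>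
          A * t.1 ^ ((i : ℕ) + 1) + B * t.2.1 ^ ((i : ℕ) + 1) = C * t.2.2 ^ ((i : ℕ) + 1) ∧
          Nat.Coprime (A * t.1 ^ ((i : ℕ) + 1)) (B * t.2.1 ^ ((i : ℕ) + 1))).card := by
      refine card_le_card_of_injOn (fun t => (t.1 i, t.2.1 i, t.2.2 i)) (fun t ht => ?_)
        (fun t ht t' ht' h => ?_)
      · obtain ⟨⟨hbx', hby', hbz'⟩, -, heq, hcop⟩ := hmem t (mem_coe.mp ht)
        rw [mem_coe, mem_filter, mem_product, mem_product, mem_range, mem_range, mem_range]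
        exact ⟨⟨((mem_dyadicBox.mp hbx') i).2, ((mem_dyadicBox.mp hby') i).2,
          ((mem_dyadicBox.mp hbz') i).2⟩, heq, hcop⟩
      · obtain ⟨-, ⟨f1, f2, f3⟩, -, -⟩ := hmem t (mem_coe.mp ht)
        obtain ⟨-, ⟨f1', f2', f3'⟩, -, -⟩ := hmem t' (mem_coe.mp ht')
        simp only [Prod.mk.injEq] at h
        obtain ⟨hx, hy, hz⟩ := h
        have key : ∀ (W u u' : Fin d → ℕ), freezeOn S W u = freezeOn S W u' → u i = u' i →
            u = u' := by
          intro W u u' hf hui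
          funext j
          by_cases hj : j = i
          · rw [hj]; exact hui
          · have hjS : j ∉ S := by simp [hS, hj]
            have := congrFun hf j
            simpa [freezeOn, hjS] using this
        exact Prod.ext (key X _ _ (f1.trans f1'.symm) hx)
          (Prod.ext (key Y _ _ (f2.trans f2'.symm) hy) (key Z _ _ (f3.trans f3'.symm) hz))
    have hfo := hinj.trans (detToolFibre hi hApos hBpos hCpos hp hpm hsize (hD A hApos.ne' hAT)
      (hD B hBpos.ne' hBT) (hD C hCpos.ne' hCT))
    -- to the real bound
    calc (Fo.card : ℝ) ≤ ((2 * ((i : ℕ) + 2) * (3 * (((i : ℕ) + 1) * p)) *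
          (Dτ ^ ((i : ℕ) + 2) * Dτ ^ ((i : ℕ) + 2) * Dτ ^ ((i : ℕ) + 2)) : ℕ) : ℝ) := by
          exact_mod_cast hfo
      _ = 6 * ((((i : ℕ) : ℝ) + 1) * (((i : ℕ) : ℝ) + 2)) * (p : ℝ) *
            (Dτ : ℝ) ^ (3 * ((i : ℕ) + 2)) := by push_cast; ring
      _ ≤ 6 * ((((i : ℕ) : ℝ) + 1) * (((i : ℕ) : ℝ) + 2)) * (2 * P) *
            (Dτ : ℝ) ^ (3 * ((i : ℕ) + 2)) := by gcongr
      _ = Bnd / 2 := by rw [hBnd]; ring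
      _ ≤ Bnd := half_le_self hBnd0
  /- summing over the fibres -/
  calc (shapeCount c₁ c₂ c₃ X Y Z : ℝ) = (F.card : ℝ) := rfl
    _ = ∑ o ∈ O, ((F.filter (fun t => φ t = o)).card : ℝ) := by
        rw [card_eq_sum_card_fiberwise hmaps]; push_cast; rfl
    _ ≤ ∑ o ∈ O, Bnd := sum_le_sum hfib
    _ = O.card * Bnd := by rw [sum_const, nsmul_eq_mul]
    _ = _ := by rw [hO, card_product, card_product, hBnd]; push_cast; ring

end Summit.ABC.ABC.Theorems.MazurKaneLaw
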